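import Summits.BirchSwinnertonDyer.BirchSwinnertonDyer.Theorems.ManinLocalTwoThreeManinPrimeToAdditiveFiveLeBistarredGord
import Summits.BirchSwinnertonDyer.BirchSwinnertonDyer.Theorems.ManinLocalTwoThreeManinPrimeToAdditiveFiveLeReducibleThirteenDegreeUp
import HarnessLib

/-!
# Route `ManinLocalTwoThree`, residual crux C5 `ManinPrimeToAdditiveFiveLe`
# (stmt-BirchSwinnertonDyer-22969), line `upper_anchor`: **the by-name ledger after λ — C5 from SEVEN
# cite-only printed facts, KP57, and the three typed residual cores of skeleton v6 with the bi-starred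
# corner cut down to its potentially supersingular half**

Width seat bsd-line-ml23-c5-p1-w2 (gen 3), piece λ3 (HOME STATUS 2026-08-28). One theorem, no new
mathematics: the gen-2 ledger `maninPrimeToAdditiveFiveLe_of_kato57_print_mazurJ_of_kp57_of_splitCores`
(p617914) fed with λ (`red57bistarred_of_dokchitser_of_nonGordCorner`, p621355: the (G)-ordinary half of the
bi-starred corner is empty by Dokchitser–Dokchitser 2015 Thm. 5.1 (1)) and with the lead's RED(13♯) reduction to
the Manin-free degree law (`coreRED13sharp_of_edixhovenKodairaFact_of_degreeUp13Red`, p618203):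

`maninPrimeToAdditiveFiveLe_of_print_dokchitser_of_kp57_of_unstarred_nonGordCorner_degreeUp13` —
**C5 BY NAME ⟸ {Kato F″, ČNS Thm. 1.2, Cremona ≤ 5·10⁵, Edixhoven Thm. 3 (Kodaira half, ordinarity half),
Mazur's `X₀(p)` list, Dokchitser–Dokchitser Thm. 5.1 (1)} (seven cite-only facts) ∧ KP57 (stmt-23810, by name)
∧ RED(57♯)[unstarred] (= `stub_red57unstarred` of v6) ∧ RED(57♯)[bi-starred ∧ NOT (G)-ordinary] (= `hB'` of
p621355) ∧ `DegreeUp13Red` (= `stub_degreeUp13Red` of v6).**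

So after λ the typed residual of C5 on line `upper_anchor` is: the unstarred `W[p]`-reducible half at
`p ∈ {5,7}` (no lever in tree or print), the potentially supersingular bi-starred corner (Kodaira (5; IV*/II*),
(7; III*); 0 in Cremona's range; vacuous under «optimal ⟹ unstarred», p621355 §2), the Manin-free degree law at
`13` (= E-an-33 at `13` ∧ no flip, p619077), and KP57 — everything else is print. Conditional result
(`--supports … --as helper`); C5 is NOT proved; nothing here proves BSD or Manin's conjecture.

References: [Kato2004Asterisque] (8.1.3), Thm. 9.7; [CesnaviciusNeururerSaha2023] Thm. 1.2; [EdixhovenManin1991]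
Thm. 3; [Mazur1978] Thm. 1; [DokchitserDokchitser2015LocalInvariants] Thm. 5.1 (1); [KostersPannekoek2017] Cor. 2.
-/

set_option autoImplicit false
-- the Theorems namespace of this sub repeats the summit name by design (D-0017 nested layout)
set_option linter.dupNamespace false

noncomputable section

open scoped Classical NumberField

namespace Summit.BirchSwinnertonDyer.BirchSwinnertonDyer.Theorems

open WeierstrassCurve IsDedekindDomain IsDedekindDomain.HeightOneSpectrum Rat.HeightOneSpectrum NumberField
  Literature.NumberTheory.EllipticCurves Literature.NumberTheory.EllipticCurves.ModularForms
  Literature.NumberTheory.EllipticCurves.Rank1Residual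
  Summit.BirchSwinnertonDyer.Rank1Residual.ManinAdditive
  Summit.BirchSwinnertonDyer.Rank1Residual.Additive
  Summit.BirchSwinnertonDyer.BirchSwinnertonDyer.Theses.EdixhovenFibreFiveSeven

/-- **C5 `ManinPrimeToAdditiveFiveLe` BY NAME ⟸ seven printed facts ∧ KP57 ∧ RED(57♯)[unstarred] ∧
RED(57♯)[bi-starred, not (G)-ordinary] ∧ `DegreeUp13Red`** (the line ledger after λ; conditional-result, C5 is
NOT proved). Printed inputs (cite-only `def … : Prop`): Kato F″ (`hK57`), ČNS Thm. 1.2 (`hCNS`), Cremona's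
table (`h500k`), Edixhoven Thm. 3 ×2 (`hEdK`, `hEdG`), Mazur's `X₀(p)` list (`hJ`), Dokchitser–Dokchitser
Thm. 5.1 (1) (`hDD`). Items: KP57 = stmt-BirchSwinnertonDyer-23810 by name (`hKP57`). Typed residual cores:
`h57l` = `stub_red57unstarred` (v6), `h57b` = the bi-starred corner on NON-(G)-ordinary `W` (p621355's `hB'`),
`hUp` = `stub_degreeUp13Red` (v6). Proof: p617914 ∘ p621355 ∘ p618203.
[cite: DokchitserDokchitser2015LocalInvariants, Thm. 5.1 (1)] [cite: EdixhovenManin1991, Thm. 3]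
[cite: CesnaviciusNeururerSaha2023, Thm. 1.2] [cite: Kato2004Asterisque, (8.1.3) (p. 180), Thm. 9.7 (p. 189)]
[cite: Mazur1978, Thm. 1] -/
theorem maninPrimeToAdditiveFiveLe_of_print_dokchitser_of_kp57_of_unstarred_nonGordCorner_degreeUp13
    (hK57 : kato_neron_isIntegral_twistedSymbolSum_of_additive_five_le)
    (hCNS : cesnaviciusNeururerSaha_padicVal_maninConstant_le_modularDegree)
    (h500k : cremona_abs_maninConstant_eq_one_of_level_le_500000)
    (hEdK : edixhoven_not_dvd_maninConstant_of_kodairaSymbol_ne)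
    (hEdG : edixhoven_not_dvd_maninConstant_of_not_potentiallyGoodOrdinary)
    (hJ : mazur_j_mem_of_not_hasIrreducibleModPGaloisRep_of_eleven_le)
    (hDD : dokchitser_padicValInt_minimalDiscriminantInt_eq_of_isogeny_of_potentiallyGoodOrdinary)
    (hKP57 : KPResidueManinUnitFiveSeven)
    (h57l : mazur_not_dvd_maninConstant_of_odd → abbesUllmo_not_dvd_maninConstant_of_not_dvd_level →
      cesnavicius_not_two_dvd_maninConstant_of_two_dvd_level → exists_isNewformOf →
      ∀ (W : WeierstrassCurve ℚ) [W.IsElliptic] [W.IsGloballyMinimal] [NeZero (W.conductorNorm ℤ)]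
        (D : ModularParametrizationData W (W.conductorNorm ℤ)),
        IsLatticeOptimal D → ∀ (p : ℕ) (hp : p.Prime), (p = 5 ∨ p = 7) → p ^ 2 ∣ W.conductorNorm ℤ →
        ¬ (∃ (W' : WeierstrassCurve ℚ) (q : ℕ), W'.IsElliptic ∧ W'.IsGloballyMinimal ∧ q.Prime ∧
            q ≠ 2 ∧ q ^ 2 ∣ W.conductorNorm ℤ ∧
            IsIsogenous W (W'.quadraticTwist (((-1 : ℤ) ^ (q / 2) * q : ℤ) : ℚ)) ∧
            ¬ q ^ 2 ∣ W'.conductorNorm ℤ) →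
        ¬ (∃ (W' : WeierstrassCurve ℚ) (d : ℤ), W'.IsElliptic ∧ W'.IsGloballyMinimal ∧
            (d = -1 ∨ d = 2 ∨ d = -2) ∧ 2 ^ 2 ∣ W.conductorNorm ℤ ∧
            IsIsogenous W (W'.quadraticTwist (d : ℚ)) ∧ ¬ 2 ^ 2 ∣ W'.conductorNorm ℤ) →
        ¬ W.HasIrreducibleModPGaloisRep p →
        500000 < W.conductorNorm ℤ →
        p ∣ D.modularDegree →
        (∀ n : ℕ, W.kodairaSymbolAt ((Rat.HeightOneSpectrum.primesEquiv (R := ℤ)).symm ⟨p, hp⟩) ≠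
          .Istar n) →
        padicValInt p W.minimalDiscriminantInt ≤ 4 →
        ¬ (p : ℤ) ∣ D.maninConstant)
    (h57b : mazur_not_dvd_maninConstant_of_odd → abbesUllmo_not_dvd_maninConstant_of_not_dvd_level →
      cesnavicius_not_two_dvd_maninConstant_of_two_dvd_level → exists_isNewformOf →
      ∀ (W : WeierstrassCurve ℚ) [W.IsElliptic] [W.IsGloballyMinimal] [NeZero (W.conductorNorm ℤ)]
        (D : ModularParametrizationData W (W.conductorNorm ℤ)),
        IsLatticeOptimal D → ∀ (p : ℕ) (hp : p.Prime), (p = 5 ∨ p = 7) → p ^ 2 ∣ W.conductorNorm ℤ →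
        ¬ (∃ (W' : WeierstrassCurve ℚ) (q : ℕ), W'.IsElliptic ∧ W'.IsGloballyMinimal ∧ q.Prime ∧
            q ≠ 2 ∧ q ^ 2 ∣ W.conductorNorm ℤ ∧
            IsIsogenous W (W'.quadraticTwist (((-1 : ℤ) ^ (q / 2) * q : ℤ) : ℚ)) ∧
            ¬ q ^ 2 ∣ W'.conductorNorm ℤ) →
        ¬ (∃ (W' : WeierstrassCurve ℚ) (d : ℤ), W'.IsElliptic ∧ W'.IsGloballyMinimal ∧
            (d = -1 ∨ d = 2 ∨ d = -2) ∧ 2 ^ 2 ∣ W.conductorNorm ℤ ∧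
            IsIsogenous W (W'.quadraticTwist (d : ℚ)) ∧ ¬ 2 ^ 2 ∣ W'.conductorNorm ℤ) →
        ¬ W.HasIrreducibleModPGaloisRep p →
        500000 < W.conductorNorm ℤ →
        p ∣ D.modularDegree →
        (∀ n : ℕ, W.kodairaSymbolAt ((Rat.HeightOneSpectrum.primesEquiv (R := ℤ)).symm ⟨p, hp⟩) ≠
          .Istar n) →
        4 < padicValInt p W.minimalDiscriminantInt →
        ¬ TypeGOrd W p →
        (∀ (W₀ : WeierstrassCurve ℚ) [W₀.IsElliptic] [W₀.IsGloballyMinimal] [NeZero (W₀.conductorNorm ℤ)]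
            (D₀ : ModularParametrizationData W₀ (W₀.conductorNorm ℤ)), IsLatticeOptimal D₀ →
            IsIsogenous (W.quadraticTwist ((((-1 : ℤ) ^ (p / 2) * p : ℤ)) : ℚ)) W₀ →
            4 < padicValInt p W₀.minimalDiscriminantInt) →
        ¬ (p : ℤ) ∣ D.maninConstant)
    (hUp : exists_isNewformOf →
      ∀ (W : WeierstrassCurve ℚ) [W.IsElliptic] [W.IsGloballyMinimal] [NeZero (W.conductorNorm ℤ)]
        (D : ModularParametrizationData W (W.conductorNorm ℤ)),
        IsLatticeOptimal D → ∀ p : ℕ, p.Prime → p = 13 → p ^ 2 ∣ W.conductorNorm ℤ →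
        ¬ (∃ (W' : WeierstrassCurve ℚ) (q : ℕ), W'.IsElliptic ∧ W'.IsGloballyMinimal ∧ q.Prime ∧
            q ≠ 2 ∧ q ^ 2 ∣ W.conductorNorm ℤ ∧
            IsIsogenous W (W'.quadraticTwist (((-1 : ℤ) ^ (q / 2) * q : ℤ) : ℚ)) ∧
            ¬ q ^ 2 ∣ W'.conductorNorm ℤ) →
        ¬ (∃ (W' : WeierstrassCurve ℚ) (d : ℤ), W'.IsElliptic ∧ W'.IsGloballyMinimal ∧
            (d = -1 ∨ d = 2 ∨ d = -2) ∧ 2 ^ 2 ∣ W.conductorNorm ℤ ∧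
            IsIsogenous W (W'.quadraticTwist (d : ℚ)) ∧ ¬ 2 ^ 2 ∣ W'.conductorNorm ℤ) →
        ¬ W.HasIrreducibleModPGaloisRep p →
        padicValInt p W.minimalDiscriminantInt ≤ 4 →
        (∃ (L : Type) (_ : Field L) (_ : NumberField L) (_ : IsCyclotomicExtension {p} ℚ L)
            (F : IntermediateField ℚ L),
            ∀ w : HeightOneSpectrum (𝓞 F), (p : 𝓞 F) ∈ w.asIdeal →
              (W.baseChange F).HasGoodReductionAt w ∧ (W.baseChange F).HasUnitRootAt w) →
        p ∣ D.modularDegree →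
        500000 < W.conductorNorm ℤ →
        ∀ (W' : WeierstrassCurve ℚ) [W'.IsElliptic] [W'.IsGloballyMinimal] [NeZero (W'.conductorNorm ℤ)]
          (D' : ModularParametrizationData W' (W'.conductorNorm ℤ)),
          IsLatticeOptimal D' → W'.conductorNorm ℤ = W.conductorNorm ℤ →
          IsIsogenous (W.quadraticTwist (((-1 : ℤ) ^ (p / 2) * p : ℤ) : ℚ)) W' →
          D'.modularDegree = p * D.modularDegree) :
    Summit.BirchSwinnertonDyer.BirchSwinnertonDyer.Theses.ManinLocalTwoThree.ManinPrimeToAdditiveFiveLe :=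
  maninPrimeToAdditiveFiveLe_of_kato57_print_mazurJ_of_kp57_of_splitCores hK57 hCNS h500k hEdK hEdG hJ hKP57
    h57l (red57bistarred_of_dokchitser_of_nonGordCorner hDD h57b)
    (coreRED13sharp_of_edixhovenKodairaFact_of_degreeUp13Red hEdK hUp)

end Summit.BirchSwinnertonDyer.BirchSwinnertonDyer.Theorems

end
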